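import Summits.Langlands.Langlands.Theses.OrdinaryPrimeTransport
import Literature.NumberTheory.Automorphic.AutomorphicInductionUnitaryCharacterCubic
import Literature.NumberTheory.Automorphic.IsAutomorphicAE
import HarnessLib

/-!
# SKELETON — line `QuarticInducedCharacterReciprocity` for the crux `ReciprocityUpToIrreducibility`
# (item stmt-Langlands-14328; routes IrreducibilityBySelfDuality / OrdinaryPrimeTransport)
# forward generator G4 ladder-down, generation 19 (unit fwd2-ladder-Langlands-14328-g19)

Dial θ21 = the DEGREE `d = [E:F]` of a NOT-NECESSARILY-GALOIS extension `E/F` of ARBITRARY number fields in the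
INDUCED-FROM-CHARACTER sector of clause (B) of the top E = `ReciprocityUpToIrreducibility`: clause (B) (a.e. Satake
form) for irreducible geometric `ρ : Γ_F → GL_d(ℚ̄_ℓ)` whose Frobenius characteristic polynomials are, at almost every
place `v` of `F`, the induced polynomials `∏_{w ∣ v} (X^{f(w|v)} - θ(ϖ_w))` of a unitary idèle class character `θ` of
`E` (read through `ι : ℚ̄_ℓ ≃ ℂ` in the tree's `L`-normalised dictionary `arithFrobPolyOfSatake`) — i.e. AUTOMORPHIC
INDUCTION OF IDÈLE CLASS CHARACTERS ALONG ARBITRARY DEGREE-`d` EXTENSIONS, typed inside (B).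

FLOOR `d = 3` = Jacquet–Piatetski-Shapiro–Shalika 1979 (GL(3) converse theorem; Gelbart 1997 Thm. 5.3.1 / Rem. 5.3.1
(e): "does not depend on K being a normal extension"): in-tree named fact
`Literature.NumberTheory.Automorphic.automorphicInduction_unitaryCharacter_cubic`, clause (1) — `floor_three` below
(five lines).  THE RUNG `d = 4` (`QuarticInducedCharacterReciprocity`): automorphic induction of unitary characters
along ARBITRARY QUARTIC extensions.  Quartics with an intermediate quadratic field (Galois closure `C₄, V₄, D₄`) are
towers of cyclic steps (Arthur–Clozel) — the in-print sub-cell `stub_imprimitiveQuartic`; PRIMITIVE quartics (closure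
`A₄ / S₄`, no intermediate field) are the OPEN CORE `stub_primitiveQuartic`: the `GL(4)` converse theorem needs
`GL(2)`-twisted functional equations, i.e. base change of `GL₂` cusp forms along the non-normal quartic, and solvable
descent `M' → K₂ → F` of the Arthur–Clozel lift leaves an unpinned cubic / quadratic twist at inert places
(Getz–Hahn GTM 300 p. 262: "The case of an arbitrary extension E/F is open"; Harris–Taylor Prop. VII.2.7 = soluble
closure under CM / regularity / inert-place hypotheses only; Kim, Invent. 156 (2004) = ONE non-normal quintic example).

Seven registered stubs; kernel-checked composition `ReciprocityUpToIrreducibility_of : <stub₁-sig> → … → <stub₇-sig> → E`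
and `reciprocityUpToIrreducibility_holds` (this PUBLISHED tree copy concludes the OrdinaryPrimeTransport decl of the SHARED item stmt-Langlands-14328 —
same text as the IrreducibilityBySelfDuality decl, `Iff.rfl` — because the IrreducibilityBySelfDuality Theses module is
incoherent on the crux-write host, the g3–g18 convention; the seat-folder copy concludes the IrreducibilityBySelfDuality decl BY NAME):

* `stub_floorFact : automorphicInduction_unitaryCharacter_cubic` — the floor (JPSS 1979), in print, vendored named fact;
* `stub_lowDegrees : InducedCharacterReciprocity 1 ∧ InducedCharacterReciprocity 2` — floor debt below the floor
  (`d = 1`: `π = θ`; `d = 2`: every quadratic extension is cyclic — Labesse–Langlands / Arthur–Clozel; plausibly M);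
* `stub_imprimitiveQuartic` — `d = 4` with an intermediate quadratic field (towers of cyclic prime-degree steps; in
  print modulo isobaric bookkeeping, Arthur–Clozel Thm. 3.6.2; plausibly L);
* `stub_primitiveQuartic` — **THE OPEN CORE = BC9's cap-lifting input at this rung**: `d = 4`, NO intermediate field;
* `stub_higherDegrees : HigherDegrees` — the cells `d ≥ 5` (from `d = 5` on the closure may be insoluble: `A₅, S₅`);
* `stub_sectorMerge : (∀ d, InducedCharacterReciprocity d) → SectorGaloisToAutomorphic` — upgrade a.e.-Satake
  automorphy on the induced-character sector to clause (B) of E verbatim (cuspidal, `L`-algebraic, `Corresponds`);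
* `stub_offSector : OffSectorReciprocity` — E with clause (B) restricted OFF the sector (the honest complement).

Composition: `Rec` and clause (A) from `stub_offSector`; clause (B) by `by_cases InInducedSector F ℓ ι ρ`.
Sorries ONLY inside the seven `stub_*`.  Also recorded (sorry-free): `floor_three`, `family_zero`, `rung_of_cells`,
`family_of`, `QuarticInducedCharacterReciprocity_of_top : E → rung`,
`inducedCharacterReciprocity_of_langlands : Langlands → family d` (the F4 on-path lemma, also in `_onpath`).
-/

noncomputable section

set_option linter.dupNamespace false

open scoped MatrixGroups Matrix NumberField Classical Polynomial
open Filter IsDedekindDomain Field Polynomial NumberField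
open Literature.NumberTheory.Automorphic Literature.NumberTheory.GaloisRepresentations
open Literature.NumberTheory.PAdicHodge
open Summit.Langlands

namespace Summit.Langlands.Langlands.Cruxes.ReciprocityUpToIrreducibility.QuarticInducedCharacterReciprocity

/-- Hecke characters form a commutative group (accepted `HeckeCharacter.instCommGroup`); the trivial character
inhabits the carrier (recorded for the tribunal's carrier probe). [folklore] -/
instance instInhabitedHeckeCharacter (K : Type) [Field K] [NumberField K] : Inhabited (HeckeCharacter K) := ⟨1⟩

/-! ## 1. The family, the rung, the cells -/

/-- **The RUNG FAMILY, dial = induction degree `d = [E:F]`** (verbatim as in `_onpath` / `_special`): for all number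
fields `F`, all extensions `E/F` of degree `d` (ANY Galois closure), all unitary Hecke characters `θ` of `E`, all
`ℓ, ι` and all framed `ρ : Γ_F → GL_d(ℚ̄_ℓ)` which are irreducible, de Rham above `ℓ` (Fontaine's pinned datum) and, at
almost every place `v`, unramified with Frobenius characteristic polynomial the `ι`-transport of the induced polynomial
`∏_{w ∣ v} (X^{f(w|v)} - θ(ϖ_w))` (through any multiset `α` of its roots, in the dictionary `arithFrobPolyOfSatake`):
`ρ` is attached at almost all places to an automorphic representation of `GL_d(𝔸_F)`. -/
def InducedCharacterReciprocity (d : ℕ) : Prop :=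
  ∀ (F E : Type) [Field F] [NumberField F] [Field E] [NumberField E] [Algebra F E],
    Module.finrank F E = d →
    ∀ (θ : HeckeCharacter E), θ.IsUnitary →
      ∀ (hF : isCompact_glFiniteIntegralLevel d F) (ℓ : ℕ) [Fact ℓ.Prime] (ι : PadicAlgCl ℓ ≃+* ℂ)
        (ρ : FramedGaloisRep F (PadicAlgCl ℓ) d),
        ρ.toGaloisRep.IsIrreducible →
        (∀ (w : HeightOneSpectrum (𝓞 F)) (hw : ((ℓ : ℕ) : 𝓞 F) ∈ w.asIdeal),
            (fontainePstAdicCompletion w ℓ hw).IsDeRhamFramed (ρ.toLocal w)) →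
        (∀ᶠ v : HeightOneSpectrum (𝓞 F) in cofinite, ρ.IsUnramifiedAt v ∧
            ∀ α : Multiset ℂ, satakePolynomial α =
                ∏ᶠ w ∈ {w : HeightOneSpectrum (𝓞 E) | w.under (𝓞 F) = v},
                  (X ^ w.asIdeal.inertiaDeg (𝓞 F) - C (θ.valueAtUniformizer w)) →
              ρ.HasFrobCharpolyAt v (arithFrobPolyOfSatake ι v.residueCard 1 α)) →
        ∃ π : AutomorphicRepData (AutomorphyDatum.gl d F hF), SatakeFrobCompatibleAE ι π ρ

/-- **THE RUNG (θ21 = 4)**: induced-character reciprocity along ARBITRARY QUARTIC extensions. -/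
def QuarticInducedCharacterReciprocity : Prop := InducedCharacterReciprocity 4

/-- **The `d = 4` cell WITH an intermediate quadratic field** (Galois closure `C₄`, `V₄` or `D₄`: a tower of two
quadratic = cyclic steps) — the in-print sub-cell of the rung. -/
def ImprimitiveQuarticCell : Prop :=
  ∀ (F E : Type) [Field F] [NumberField F] [Field E] [NumberField E] [Algebra F E],
    Module.finrank F E = 4 → (∃ K : IntermediateField F E, Module.finrank F K = 2) →
    ∀ (θ : HeckeCharacter E), θ.IsUnitary →
      ∀ (hF : isCompact_glFiniteIntegralLevel 4 F) (ℓ : ℕ) [Fact ℓ.Prime] (ι : PadicAlgCl ℓ ≃+* ℂ)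
        (ρ : FramedGaloisRep F (PadicAlgCl ℓ) 4),
        ρ.toGaloisRep.IsIrreducible →
        (∀ (w : HeightOneSpectrum (𝓞 F)) (hw : ((ℓ : ℕ) : 𝓞 F) ∈ w.asIdeal),
            (fontainePstAdicCompletion w ℓ hw).IsDeRhamFramed (ρ.toLocal w)) →
        (∀ᶠ v : HeightOneSpectrum (𝓞 F) in cofinite, ρ.IsUnramifiedAt v ∧
            ∀ α : Multiset ℂ, satakePolynomial α =
                ∏ᶠ w ∈ {w : HeightOneSpectrum (𝓞 E) | w.under (𝓞 F) = v},
                  (X ^ w.asIdeal.inertiaDeg (𝓞 F) - C (θ.valueAtUniformizer w)) →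
              ρ.HasFrobCharpolyAt v (arithFrobPolyOfSatake ι v.residueCard 1 α)) →
        ∃ π : AutomorphicRepData (AutomorphyDatum.gl 4 F hF), SatakeFrobCompatibleAE ι π ρ

/-- **THE OPEN CORE of the rung — the `d = 4` cell with NO intermediate field** (PRIMITIVE quartic `E/F`, Galois
closure `A₄` or `S₄`). -/
def PrimitiveQuarticCell : Prop :=
  ∀ (F E : Type) [Field F] [NumberField F] [Field E] [NumberField E] [Algebra F E],
    Module.finrank F E = 4 → (¬ ∃ K : IntermediateField F E, Module.finrank F K = 2) →
    ∀ (θ : HeckeCharacter E), θ.IsUnitary →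
      ∀ (hF : isCompact_glFiniteIntegralLevel 4 F) (ℓ : ℕ) [Fact ℓ.Prime] (ι : PadicAlgCl ℓ ≃+* ℂ)
        (ρ : FramedGaloisRep F (PadicAlgCl ℓ) 4),
        ρ.toGaloisRep.IsIrreducible →
        (∀ (w : HeightOneSpectrum (𝓞 F)) (hw : ((ℓ : ℕ) : 𝓞 F) ∈ w.asIdeal),
            (fontainePstAdicCompletion w ℓ hw).IsDeRhamFramed (ρ.toLocal w)) →
        (∀ᶠ v : HeightOneSpectrum (𝓞 F) in cofinite, ρ.IsUnramifiedAt v ∧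
            ∀ α : Multiset ℂ, satakePolynomial α =
                ∏ᶠ w ∈ {w : HeightOneSpectrum (𝓞 E) | w.under (𝓞 F) = v},
                  (X ^ w.asIdeal.inertiaDeg (𝓞 F) - C (θ.valueAtUniformizer w)) →
              ρ.HasFrobCharpolyAt v (arithFrobPolyOfSatake ι v.residueCard 1 α)) →
        ∃ π : AutomorphicRepData (AutomorphyDatum.gl 4 F hF), SatakeFrobCompatibleAE ι π ρ

/-- The cells `d ≥ 5` of the family (from `d = 5` on the Galois closure may be insoluble). -/
def HigherDegrees : Prop := ∀ d : ℕ, 5 ≤ d → InducedCharacterReciprocity d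

/-! ## 2. Floor, vacuous cell, the rung from its two cells, every degree (sorry-free) -/

/-- **F3: the family at `d = 3` IS the floor** (JPSS 1979, clause (1) of the in-tree named fact). -/
theorem floor_three (h : automorphicInduction_unitaryCharacter_cubic) : InducedCharacterReciprocity 3 := by
  intro F E _ _ _ _ _ hd θ hθ hF ℓ _ ι ρ _hirr _hdR hfrob
  obtain ⟨π, hπ⟩ := (h F E hd θ hθ hF).1
  refine ⟨π, ?_⟩
  filter_upwards [hπ, hfrob] with v ⟨α, hα, hpoly⟩ ⟨hunr, hfr⟩
  exact ⟨α, hα, hunr, hfr α hpoly⟩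

/-- The degree-zero member is vacuous (`[E:F] ≥ 1`). -/
theorem family_zero : InducedCharacterReciprocity 0 := by
  intro F E _ _ _ _ _ hd
  exact absurd hd (Module.finrank_pos (R := F) (M := E)).ne'

/-- **The rung from its two cells** (imprimitive + primitive quartics). -/
theorem rung_of_cells (himp : ImprimitiveQuarticCell) (hprim : PrimitiveQuarticCell) :
    QuarticInducedCharacterReciprocity := by
  intro F E _ _ _ _ _ hd θ hθ hF ℓ _ ι ρ hirr hdR hfrob
  by_cases hK : ∃ K : IntermediateField F E, Module.finrank F K = 2
  · exact himp F E hd hK θ hθ hF ℓ ι ρ hirr hdR hfrob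
  · exact hprim F E hd hK θ hθ hF ℓ ι ρ hirr hdR hfrob

/-- **Every degree** from the floor fact, the low cells, the two rung cells and the higher cells. -/
theorem family_of (hfloor : automorphicInduction_unitaryCharacter_cubic)
    (hlow : InducedCharacterReciprocity 1 ∧ InducedCharacterReciprocity 2)
    (himp : ImprimitiveQuarticCell) (hprim : PrimitiveQuarticCell) (hhigh : HigherDegrees) (d : ℕ) :
    InducedCharacterReciprocity d := by
  rcases Nat.lt_or_ge d 5 with h | h
  · interval_cases d
    · exact family_zero
    · exact hlow.1
    · exact hlow.2
    · exact floor_three hfloor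
    · exact rung_of_cells himp hprim
  · exact hhigh d h

/-! ## 3. The induced-character sector of clause (B), the merge target, the off-sector complement -/

/-- **The induced-character sector of clause (B)** at `(F, ℓ, ι, ρ)`: for some extension `E/F` of degree `n` and some
unitary Hecke character `θ` of `E`, `ρ` is, at almost every place, unramified with Frobenius characteristic polynomial
the `ι`-transport of the induced polynomial of `θ` (so `ρ` "is" `Ind_E^F θ`). -/
def InInducedSector (F : Type) [Field F] [NumberField F] (ℓ : ℕ) [Fact ℓ.Prime] (ι : PadicAlgCl ℓ ≃+* ℂ) {n : ℕ}
    (ρ : FramedGaloisRep F (PadicAlgCl ℓ) n) : Prop :=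
  ∃ (E : Type) (_ : Field E) (_ : NumberField E) (_ : Algebra F E) (θ : HeckeCharacter E),
    Module.finrank F E = n ∧ θ.IsUnitary ∧
    ∀ᶠ v : HeightOneSpectrum (𝓞 F) in cofinite, ρ.IsUnramifiedAt v ∧
      ∀ α : Multiset ℂ, satakePolynomial α =
          ∏ᶠ w ∈ {w : HeightOneSpectrum (𝓞 E) | w.under (𝓞 F) = v},
            (X ^ w.asIdeal.inertiaDeg (𝓞 F) - C (θ.valueAtUniformizer w)) →
        ρ.HasFrobCharpolyAt v (arithFrobPolyOfSatake ι v.residueCard 1 α)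

/-- **Merge target**: clause (B) of E VERBATIM (cuspidal, `L`-algebraic, `Corresponds Rec ι π ρ`) for EVERY reciprocity
datum `Rec`, on the induced-character sector. -/
def SectorGaloisToAutomorphic : Prop :=
  ∀ (F : Type) [Field F] [NumberField F] (Rec : ReciprocityData F) (n : ℕ), 0 < n →
    ∀ (hcpt : isCompact_glFiniteIntegralLevel n F) (ℓ : ℕ) [Fact ℓ.Prime] (ι : PadicAlgCl ℓ ≃+* ℂ)
      (ρ : FramedGaloisRep F (PadicAlgCl ℓ) n),
      ρ.toGaloisRep.IsIrreducible → IsGeometricFramed Rec ρ → InInducedSector F ℓ ι ρ →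
        ∃ π : CuspidalAutomorphicRepData n F hcpt, π.1.IsLAlgebraic ∧ Corresponds Rec ι π.1 ρ

/-- **The off-sector complement**: E (`ReciprocityUpToIrreducibility`) with clause (A) entire and clause (B)
restricted to `ρ` NOT in the induced-character sector. -/
def OffSectorReciprocity : Prop :=
  ∀ (F : Type) [Field F] [NumberField F], ∃ Rec : ReciprocityData F, ∀ n : ℕ, 0 < n →
    ∀ hcpt : isCompact_glFiniteIntegralLevel n F,
      (∀ π : CuspidalAutomorphicRepData n F hcpt, π.1.IsLAlgebraic →
        ∀ (ℓ : ℕ) [Fact ℓ.Prime] (ι : PadicAlgCl ℓ ≃+* ℂ),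
          ∃ ρ : FramedGaloisRep F (PadicAlgCl ℓ) n, IsGeometricFramed Rec ρ ∧ Corresponds Rec ι π.1 ρ) ∧
      (∀ (ℓ : ℕ) [Fact ℓ.Prime] (ι : PadicAlgCl ℓ ≃+* ℂ) (ρ : FramedGaloisRep F (PadicAlgCl ℓ) n),
        ρ.toGaloisRep.IsIrreducible → IsGeometricFramed Rec ρ → ¬ InInducedSector F ℓ ι ρ →
          ∃ π : CuspidalAutomorphicRepData n F hcpt, π.1.IsLAlgebraic ∧ Corresponds Rec ι π.1 ρ)

/-! ## 4. The seven registered stubs -/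

/-- The floor: Jacquet–Piatetski-Shapiro–Shalika 1979 (in print; in the tree a named fact, XL to discharge). -/
theorem stub_floorFact : automorphicInduction_unitaryCharacter_cubic := by
  sorry

/-- Floor debt below the floor: `d = 1` (`π = θ` itself on `GL₁`) and `d = 2` (every quadratic extension is cyclic:
Labesse–Langlands / Arthur–Clozel automorphic induction; in print, plausibly M). -/
theorem stub_lowDegrees : InducedCharacterReciprocity 1 ∧ InducedCharacterReciprocity 2 := by
  sorry

/-- The in-print sub-cell of the rung: quartics with an intermediate quadratic field (two cyclic quadratic steps of
Arthur–Clozel, AMS 120, Thm. 3.6.2, with the isobaric bookkeeping at the second step; plausibly L). -/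
theorem stub_imprimitiveQuartic : ImprimitiveQuarticCell := by
  sorry

/-- **THE OPEN CORE**: PRIMITIVE quartics (Galois closure `A₄` / `S₄`) — non-normal quartic automorphic induction of
idèle class characters; the located stop of both printed engines (GL(4) converse theorem needs GL(2) twists = base
change of GL₂ cusp forms along the non-normal quartic; Arthur–Clozel solvable descent leaves an unpinned twist). -/
theorem stub_primitiveQuartic : PrimitiveQuarticCell := by
  sorry

/-- The cells `d ≥ 5` (insoluble closures appear: non-solvable automorphic induction). -/
theorem stub_higherDegrees : HigherDegrees := by
  sorry

/-- Upgrade a.e.-Satake automorphy on the induced-character sector to clause (B) of E verbatim (cuspidality from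
irreducibility via Jacquet–Shalika, `L`-algebraicity from the weight of `ρ`, local-global compatibility at every
place; plausibly L given clause (A)-type inputs on the sector). -/
theorem stub_sectorMerge : (∀ d : ℕ, InducedCharacterReciprocity d) → SectorGaloisToAutomorphic := by
  sorry

/-- E with clause (B) restricted OFF the induced-character sector (the honest complement). -/
theorem stub_offSector : OffSectorReciprocity := by
  sorry

/-! ## 5. Composition (no sorry below this line) -/

/-- **COMPOSITION — the crux BY NAME from the seven stub statements.**  `Rec` and clause (A) come from the off-sector
statement; clause (B) is a case split on the induced-character sector. -/
theorem ReciprocityUpToIrreducibility_of :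
    automorphicInduction_unitaryCharacter_cubic →
    (InducedCharacterReciprocity 1 ∧ InducedCharacterReciprocity 2) →
    ImprimitiveQuarticCell → PrimitiveQuarticCell → HigherDegrees →
    ((∀ d : ℕ, InducedCharacterReciprocity d) → SectorGaloisToAutomorphic) →
    OffSectorReciprocity →
    Summit.Langlands.Langlands.Theses.OrdinaryPrimeTransport.ReciprocityUpToIrreducibility := by
  intro hfloor hlow himp hprim hhigh hmerge hoff F _ _
  obtain ⟨Rec, hall⟩ := hoff F
  refine ⟨Rec, fun n hn hcpt => ⟨(hall n hn hcpt).1, ?_⟩⟩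
  intro ℓ _ ι ρ hirr hgeo
  by_cases hsec : InInducedSector F ℓ ι ρ
  · exact hmerge (family_of hfloor hlow himp hprim hhigh) F Rec n hn hcpt ℓ ι ρ hirr hgeo hsec
  · exact (hall n hn hcpt).2 ℓ ι ρ hirr hgeo hsec

/-- **THE REGISTERED SKELETON THEOREM** — the item's decl from the seven registered stubs (audit: proof-of-item modulo
the seven sorries). NOTE for reshaping: `ledger skeleton check` (`#h21_check_skeleton`) takes the FIRST theorem concluding
the crux in environment order as the skeleton and requires it to have no hypotheses beyond registered stubs; with this
name that is this theorem (the explicit composition `ReciprocityUpToIrreducibility_of` above is reported as the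
`skeleton.note` alternative) — keep the name when editing. -/
theorem reciprocityUpToIrreducibility_holds :
    Summit.Langlands.Langlands.Theses.OrdinaryPrimeTransport.ReciprocityUpToIrreducibility :=
  ReciprocityUpToIrreducibility_of stub_floorFact stub_lowDegrees stub_imprimitiveQuartic stub_primitiveQuartic
    stub_higherDegrees stub_sectorMerge stub_offSector

/-! ## 6. The rung is a consequence of the top and of the summit (sorry-free) -/

/-- `E → InducedCharacterReciprocity d` for every `d` (clause (B) of E over `F` for its own `Rec`). -/
theorem inducedCharacterReciprocity_of_top (d : ℕ)
    (hE : Summit.Langlands.Langlands.Theses.OrdinaryPrimeTransport.ReciprocityUpToIrreducibility) :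
    InducedCharacterReciprocity d := by
  intro F E _ _ _ _ _ hd θ _hθ hF ℓ _ ι ρ hirr hdR hfrob
  obtain ⟨Rec, hall⟩ := hE F
  have hd0 : 0 < d := hd ▸ Module.finrank_pos
  have hB : GaloisToAutomorphic d Rec hF := (hall d hd0 hF).2
  have hgeo : IsGeometricFramed Rec ρ := ⟨hfrob.mono fun v hv => hv.1, fun w hw => hdR w hw⟩
  obtain ⟨π, _hLalg, hcorr⟩ := hB ℓ ι ρ hirr hgeo
  exact ⟨π.1, hcorr.1⟩

/-- `E → rung`. -/
theorem QuarticInducedCharacterReciprocity_of_top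
    (hE : Summit.Langlands.Langlands.Theses.OrdinaryPrimeTransport.ReciprocityUpToIrreducibility) :
    QuarticInducedCharacterReciprocity :=
  inducedCharacterReciprocity_of_top 4 hE

/-- `Langlands → InducedCharacterReciprocity d` for every `d` (the F4 on-path lemma, also in `_onpath`). -/
theorem inducedCharacterReciprocity_of_langlands (d : ℕ) (hL : _root_.Langlands) :
    InducedCharacterReciprocity d := by
  intro F E _ _ _ _ _ hd θ _hθ hF ℓ _ ι ρ hirr hdR hfrob
  obtain ⟨⟨Rec⟩, hall⟩ := hL F
  have hd0 : 0 < d := hd ▸ Module.finrank_pos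
  have hB : GaloisToAutomorphic d Rec hF := (hall Rec d hd0 hF).2
  have hgeo : IsGeometricFramed Rec ρ := ⟨hfrob.mono fun v hv => hv.1, fun w hw => hdR w hw⟩
  obtain ⟨π, _hLalg, hcorr⟩ := hB ℓ ι ρ hirr hgeo
  exact ⟨π.1, hcorr.1⟩

end Summit.Langlands.Langlands.Cruxes.ReciprocityUpToIrreducibility.QuarticInducedCharacterReciprocity

end
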